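import Literature.AnabelianGeometry.EtaleTheta.ThetaCohomology
import Literature.AnabelianGeometry.EtaleTheta.ContH1Discrete
import HarnessLib

/-!
# Continuous `H¹` and complements: a class restricting to the identity on the coefficient subgroup
# is the same thing as a topological splitting ([EtTh] Prop. 1.5: what «`log(Θ)` lifts» means)

Classical group cohomology (Brown, *Cohomology of Groups*, Ch. IV §2, Prop. 2.1 and Prop. 2.3: an
extension by an abelian kernel splits iff it is a semi-direct product, and the splittings correspond to
derivations = 1-cocycles) [cite: Brown1982CohomologyGroups, Ch. IV §2 Prop. 2.1 and Prop. 2.3], in the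
continuous crossed-homomorphism model `ContH1` of the cell (abc-iut-L2-t1, `ContH1.lean`;
[cite: NeukirchSchmidtWingberg2008, I §2 and II §7]).

PROOF-ONLY file (no definitions; seat abc-iut-L2-t12, gen 4). For a topological group `G` acting on an
abelian normal subgroup `A ≤ G'` by conjugation through `φ : G →* G'`, subgroups `N ≤ H` of `G` and a
subgroup `K` normalising `N` with `N ⊓ K = ⊥`, and a CONTINUOUS `N`-coordinate `π : H → N` with
`π(h)⁻¹ h ∈ K` (i.e. `H = N ⋊ K` topologically — a "complement with continuous retraction"):

* `ContH1.coe_proj_mul_of_complement` — the coordinate obeys the crossed law `π(hh') = π(h) · (k π(h') k⁻¹)`,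
  `k = π(h)⁻¹ h`;
* `ContH1.exists_res_eq_mk_of_complement` — EVERY `K`-equivariant continuous cocycle `c` on `N` extends
  to `H`: `∃ x ∈ H¹(H, A), res x = [c]` (the cocycle is `h ↦ c(π h)`);
* `ContH1.res_surjective_of_complement` — hence `res : H¹(H, A) → H¹(N, A)` is SURJECTIVE as soon as
  every continuous cocycle on `N` is `K`-equivariant;
* conversely (`φ = id`, `N = A`): `ContH1.exists_complement_of_cocycle` /
  `ContH1.exists_complement_of_res_eq` — a class of `H¹(H, A)` restricting to the identity class of
  `H¹(A, A) = Hom(A, A)` produces the complement `K = {h | f h = 1}` with continuous retraction `f`.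

[EtTh] instantiation (Mochizuki, Publ. RIMS **45** (2009), §1, Prop. 1.5, PRIMS PDF pp. 22–23
[cite: MochizukiEtTh2009, Prop 1.5 p.23]): for any closed-under-nothing subgroup `H' ≤ (Π^tp_X)^Θ`
containing `Δ_Θ` (e.g. `(Π^tp_Ÿ)^Θ`, `(Π^tp_Y)^Θ`):
* `ThetaSetting.exists_res_eq_logTheta_of_complement` — a topological complement of `Δ_Θ` in `H'` gives a
  class of `H¹(H', Δ_Θ)` restricting to `log(Θ)` (the existence half of what Prop. 1.5 (iii) asserts of
  `η̈^Θ`, on the group side);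
* `ThetaSetting.res_deltaTheta_surjective_of_complement` — plus equivariance of the continuous
  endomorphisms of `Δ_Θ`, the clause `res_deltaTheta_surjective` of `Prop15i` / `Prop15ii`
  ("`F̈⁰/F̈¹ = Hom(Δ_Θ, Δ_Θ)`");
* `ThetaSetting.exists_complement_of_res_eq_logTheta` and `ThetaSetting.Prop15iii.exists_complement` —
  conversely the typed Prop. 1.5 (iii) FORCES `(Π^tp_Ÿ)^Θ = Δ_Θ ⋊ K` topologically, `K` = the kernel of
  a cocycle representing the lifted theta class.

USE (census token for the R78 χ-model cluster / any model): at a model whose `(Π^tp_Ÿ)^Θ` is a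
semidirect product over `Δ_Θ` BY CONSTRUCTION, the `Prop15*` existence clauses reduce to the displayed
equivariance; at a model where `(Π^tp_Y)^Θ` also splits, an INTEGRAL class restricting to `log(Θ)` exists
already on `Y` (compare Rmk. 1.3.1). HONEST FRAMING: classical; nothing of [EtTh] is asserted or denied;
no side taken on [IUTchIII] Cor. 3.12; typed ≠ proved.
-/

namespace Literature.AnabelianGeometry.EtaleTheta

open scoped IsMulCommutative

namespace ContH1

section Complement

variable {G G' : Type*} [Group G] [TopologicalSpace G]
  [Group G'] [TopologicalSpace G'] [IsTopologicalGroup G']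
  {φ : G →* G'} {A : Subgroup G'} [A.Normal] [IsMulCommutative A]
  {N H K : Subgroup G}

omit [TopologicalSpace G] in
/-- In a decomposition `H = N · K` with `N ⊓ K = ⊥`, the `N`-coordinate is the identity on `N`.
[cite: Brown1982CohomologyGroups, Ch. IV §2 Prop. 2.1 and Prop. 2.3] -/
theorem proj_apply_of_mem_of_complement (hNH : N ≤ H) (hdisj : Disjoint N K) (π : H → N)
    (hπK : ∀ h : H, ((π h : G))⁻¹ * (h : G) ∈ K) (n : G) (hn : n ∈ N) :
    (π ⟨n, hNH hn⟩ : G) = n := by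
  have hk := hπK ⟨n, hNH hn⟩
  have hN : ((π ⟨n, hNH hn⟩ : G))⁻¹ * n ∈ N := N.mul_mem (N.inv_mem (π _).2) hn
  have h1 : ((π ⟨n, hNH hn⟩ : G))⁻¹ * n = 1 := by
    have := (Subgroup.disjoint_def.mp hdisj) hN hk
    exact this
  rw [inv_mul_eq_one] at h1
  exact h1

omit [TopologicalSpace G] in
/-- Uniqueness of the `N · K` decomposition when `N ⊓ K = ⊥`.
[cite: Brown1982CohomologyGroups, Ch. IV §2 Prop. 2.1 and Prop. 2.3] -/
theorem eq_of_mul_eq_mul_of_complement (hdisj : Disjoint N K) {n₁ n₂ k₁ k₂ : G}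
    (hn₁ : n₁ ∈ N) (hn₂ : n₂ ∈ N) (hk₁ : k₁ ∈ K) (hk₂ : k₂ ∈ K) (h : n₁ * k₁ = n₂ * k₂) :
    n₁ = n₂ := by
  have hN : n₂⁻¹ * n₁ ∈ N := N.mul_mem (N.inv_mem hn₂) hn₁
  have hK : n₂⁻¹ * n₁ ∈ K := by
    have : n₂⁻¹ * n₁ = k₂ * k₁⁻¹ := by
      rw [inv_mul_eq_iff_eq_mul, ← mul_assoc, ← h, mul_inv_cancel_right]
    rw [this]
    exact K.mul_mem hk₂ (K.inv_mem hk₁)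
  have h1 : n₂⁻¹ * n₁ = 1 := (Subgroup.disjoint_def.mp hdisj) hN hK
  rw [inv_mul_eq_one] at h1
  exact h1.symm

omit [TopologicalSpace G] in
/-- **The crossed law of the coordinate**: for `H = N · K` with `K` normalising `N` and `N ⊓ K = ⊥`, the
`N`-coordinate satisfies `π(hh') = π(h) · (k π(h') k⁻¹)` with `k = π(h)⁻¹ h ∈ K`.
[cite: Brown1982CohomologyGroups, Ch. IV §2 Prop. 2.1 and Prop. 2.3] -/
theorem coe_proj_mul_of_complement (hKN : K ≤ Subgroup.normalizer (N : Set G))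
    (hdisj : Disjoint N K) (π : H → N) (hπK : ∀ h : H, ((π h : G))⁻¹ * (h : G) ∈ K) (h h' : H) :
    (π (h * h') : G) =
      π h * ((((π h : G))⁻¹ * h) * π h' * (((π h : G))⁻¹ * h)⁻¹) := by
  set k : G := ((π h : G))⁻¹ * h with hk_def
  set k' : G := ((π h' : G))⁻¹ * h' with hk'_def
  have hk : k ∈ K := hπK h
  have hk' : k' ∈ K := hπK h'
  have hh : (h : G) = π h * k := by rw [hk_def, mul_inv_cancel_left]
  have hh' : (h' : G) = π h' * k' := by rw [hk'_def, mul_inv_cancel_left]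
  -- `k π(h') k⁻¹ ∈ N`
  have hconj : k * π h' * k⁻¹ ∈ N := (Subgroup.mem_normalizer_iff.mp (hKN hk) _).mp (π h').2
  -- the two decompositions of `h h'`
  have hdec : (π (h * h') : G) * ((((π (h * h') : G)))⁻¹ * (h * h' : H)) =
      (π h * (k * π h' * k⁻¹)) * (k * k') := by
    rw [mul_inv_cancel_left, Subgroup.coe_mul, hh, hh']
    group
  exact eq_of_mul_eq_mul_of_complement hdisj (π (h * h')).2 (N.mul_mem (π h).2 hconj) (hπK _)
    (K.mul_mem hk hk') hdec

/-- **Extension of equivariant cocycles across a topological semidirect product.** If `H = N · K`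
(`K` normalising `N`, `N ⊓ K = ⊥`) with CONTINUOUS `N`-coordinate `π`, then every continuous cocycle
`c` on `N` which is `K`-equivariant (`c(k n k⁻¹) = φ(k) c(n) φ(k)⁻¹`) is the restriction of a class of
`H¹(H, A)` — namely of the cocycle `h ↦ c(π h)`.
[cite: Brown1982CohomologyGroups, Ch. IV §2 Prop. 2.1 and Prop. 2.3] -/
theorem exists_res_eq_mk_of_complement (hNH : N ≤ H)
    (hKN : K ≤ Subgroup.normalizer (N : Set G)) (hdisj : Disjoint N K) (π : H → N)
    (hπK : ∀ h : H, ((π h : G))⁻¹ * (h : G) ∈ K) (hπc : Continuous π)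
    (c : contCocycles φ A N)
    (hcK : ∀ k : G, k ∈ K → ∀ n n' : N, k * n * k⁻¹ = n' →
      ((c.1 n' : A) : G') = φ k * c.1 n * (φ k)⁻¹) :
    ∃ x : ContH1 φ A H, ContH1.res φ A hNH x = ContH1.mk c.1 c.2 := by
  -- the extended cocycle
  have hf : (fun h : H => c.1 (π h)) ∈ contCocycles φ A H := by
    refine ⟨c.2.1.comp hπc, fun h h' => ?_⟩
    have hk : ((π h : G))⁻¹ * h ∈ K := hπK h
    have hconj : ((π h : G))⁻¹ * h * π h' * (((π h : G))⁻¹ * h)⁻¹ ∈ N :=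
      (Subgroup.mem_normalizer_iff.mp (hKN hk) _).mp (π h').2
    have hπ : π (h * h') = π h * ⟨_, hconj⟩ :=
      Subtype.ext (by rw [Subgroup.coe_mul]; exact coe_proj_mul_of_complement hKN hdisj π hπK h h')
    change c.1 (π (h * h')) = c.1 (π h) * MulAut.conjNormal (φ (h : G)) (c.1 (π h'))
    rw [hπ, c.2.2]
    congr 1
    apply Subtype.ext
    rw [MulAut.conjNormal_apply, MulAut.conjNormal_apply, hcK _ hk (π h') ⟨_, hconj⟩ rfl]
    simp only [map_mul, map_inv]
    group
  refine ⟨ContH1.mk _ hf, ?_⟩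
  change ContH1.mk _ (ContH1.resCocycle φ A hNH ⟨_, hf⟩).2 = _
  refine ContH1.mk_congr N (funext fun n => ?_) _ _
  change c.1 (π ⟨n, hNH n.2⟩) = c.1 n
  have hn : π ⟨n, hNH n.2⟩ = n :=
    Subtype.ext (proj_apply_of_mem_of_complement hNH hdisj π hπK n n.2)
  rw [hn]

/-- **Surjectivity of restriction onto a topologically complemented subgroup**: if `H = N ⋊ K`
topologically (continuous `N`-coordinate) and every continuous cocycle on `N` is `K`-equivariant, then
`res : H¹(H, A) → H¹(N, A)` is surjective. [cite: Brown1982CohomologyGroups, Ch. IV §2 Prop. 2.1 and Prop. 2.3] -/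
theorem res_surjective_of_complement (hNH : N ≤ H)
    (hKN : K ≤ Subgroup.normalizer (N : Set G)) (hdisj : Disjoint N K) (π : H → N)
    (hπK : ∀ h : H, ((π h : G))⁻¹ * (h : G) ∈ K) (hπc : Continuous π)
    (hK : ∀ c : contCocycles φ A N, ∀ k : G, k ∈ K → ∀ n n' : N, k * n * k⁻¹ = n' →
      ((c.1 n' : A) : G') = φ k * c.1 n * (φ k)⁻¹) :
    Function.Surjective (ContH1.res φ A hNH) := by
  intro y
  induction y using QuotientGroup.induction_on with
  | H c =>
    obtain ⟨x, hx⟩ := exists_res_eq_mk_of_complement hNH hKN hdisj π hπK hπc c (hK c)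
    exact ⟨x, hx⟩

end Complement

/-! ### Converse: a class restricting to the identity produces the complement (`φ = id`, `N = A`) -/

section Converse

variable {G : Type*} [Group G] [TopologicalSpace G] [IsTopologicalGroup G]
  {A : Subgroup G} [A.Normal] [IsMulCommutative A] {H : Subgroup G}

/-- On the abelian coefficient group itself (acting by conjugation, i.e. trivially) a continuous cocycle
is determined ON THE NOSE by its class: two cocycles `A → A` with the same class are equal.
[cite: Brown1982CohomologyGroups, Ch. IV §2 Prop. 2.1 and Prop. 2.3] -/
theorem cocycle_eq_of_mk_eq_self (f g : A → A) (hf : f ∈ contCocycles (MonoidHom.id G) A A)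
    (hg : g ∈ contCocycles (MonoidHom.id G) A A) (hfg : ContH1.mk f hf = ContH1.mk g hg) : f = g := by
  obtain ⟨a, ha⟩ := (ContH1.mk_eq_mk_iff A f g hf hg).mp hfg
  funext b
  have hb := ha b
  have htriv : MulAut.conjNormal ((MonoidHom.id G) (b : G)) a = a := by
    apply Subtype.ext
    rw [MulAut.conjNormal_apply, MonoidHom.id_apply, ← Subgroup.coe_mul, mul_comm b a,
      Subgroup.coe_mul, mul_inv_cancel_right]
  rw [htriv, mul_inv_cancel, inv_mul_eq_one] at hb
  exact hb

/-- The identity map of the abelian coefficient group is a continuous cocycle of `A` acting on itself by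
conjugation ([EtTh]'s `log(Θ)`, p. 23). [cite: Brown1982CohomologyGroups, Ch. IV §2 Prop. 2.1 and Prop. 2.3] -/
theorem id_mem_contCocycles : (fun a : A => a) ∈ contCocycles (MonoidHom.id G) A A := by
  refine ⟨continuous_id, fun g h => ?_⟩
  change g * h = g * MulAut.conjNormal ((MonoidHom.id G) (g : G)) h
  congr 1
  apply Subtype.ext
  rw [MulAut.conjNormal_apply, MonoidHom.id_apply, ← Subgroup.coe_mul, mul_comm g h, Subgroup.coe_mul,
    mul_inv_cancel_right]

/-- **From a cocycle to the complement.** A continuous cocycle `f : H → A` (`A ≤ H`, conjugation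
action) with `f|_A = id` has kernel `K = {h ∈ H | f h = 1}` a subgroup with `K ≤ H`, `A ⊓ K = ⊥`,
`H = A · K`, the `A`-coordinate of `h` being `f h` (so the retraction is continuous).
[cite: Brown1982CohomologyGroups, Ch. IV §2 Prop. 2.1 and Prop. 2.3] -/
theorem exists_complement_of_cocycle (hAH : A ≤ H) (f : contCocycles (MonoidHom.id G) A H)
    (hf : ∀ a : A, f.1 ⟨a, hAH a.2⟩ = a) :
    ∃ K : Subgroup G, K ≤ H ∧ K ≤ Subgroup.normalizer (A : Set G) ∧ Disjoint A K ∧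
      (∀ h : H, ((f.1 h : G))⁻¹ * (h : G) ∈ K) ∧ ∀ h : H, (h : G) ∈ K ↔ f.1 h = 1 := by
  have hmul : ∀ h h' : H, f.1 h = 1 → f.1 h' = 1 → f.1 (h * h') = 1 := fun h h' h1 h2 => by
    rw [f.2.2, h1, h2, map_one, mul_one]
  have hinv : ∀ h : H, f.1 h = 1 → f.1 h⁻¹ = 1 := fun h h1 => by
    have h2 : f.1 (h⁻¹ * h) = 1 := by rw [inv_mul_cancel]; exact cocycle_map_one f
    rw [f.2.2, h1, map_one, mul_one] at h2
    exact h2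
  let K : Subgroup G :=
    { carrier := {g | ∃ hg : g ∈ H, f.1 ⟨g, hg⟩ = 1}
      one_mem' := ⟨H.one_mem, cocycle_map_one f⟩
      mul_mem' := by
        rintro a b ⟨ha, ha1⟩ ⟨hb, hb1⟩
        exact ⟨H.mul_mem ha hb, hmul ⟨a, ha⟩ ⟨b, hb⟩ ha1 hb1⟩
      inv_mem' := by
        rintro a ⟨ha, ha1⟩
        exact ⟨H.inv_mem ha, hinv ⟨a, ha⟩ ha1⟩ }
  have hKH : K ≤ H := fun g ⟨hg, _⟩ => hg
  have hmemK : ∀ h : H, (h : G) ∈ K ↔ f.1 h = 1 := fun h =>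
    ⟨fun ⟨_, h1⟩ => h1, fun h1 => ⟨h.2, h1⟩⟩
  refine ⟨K, hKH, Subgroup.le_normalizer_of_normal, ?_, ?_, hmemK⟩
  · rw [Subgroup.disjoint_def]
    rintro a haA ⟨haH, ha1⟩
    have := hf ⟨a, haA⟩
    rw [ha1] at this
    exact congrArg Subtype.val this.symm |>.trans rfl
  · intro h
    have hfa : ((f.1 h : G))⁻¹ ∈ A := A.inv_mem (f.1 h).2
    refine ⟨H.mul_mem (hAH hfa) h.2, ?_⟩
    have hsplit : (⟨((f.1 h : G))⁻¹ * h, H.mul_mem (hAH hfa) h.2⟩ : H) =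
        ⟨((f.1 h : G))⁻¹, hAH hfa⟩ * h := rfl
    rw [hsplit, f.2.2]
    have h1 : f.1 ⟨((f.1 h : G))⁻¹, hAH hfa⟩ = (f.1 h)⁻¹ := by
      have := hf ⟨_, hfa⟩
      rw [this]
      exact Subtype.ext rfl
    rw [h1]
    have h2 : MulAut.conjNormal ((MonoidHom.id G) (((⟨((f.1 h : G))⁻¹, hAH hfa⟩ : H) : G)))
        (f.1 h) = f.1 h := by
      apply Subtype.ext
      rw [MulAut.conjNormal_apply, MonoidHom.id_apply]
      change ((f.1 h : G))⁻¹ * (f.1 h : G) * (((f.1 h : G))⁻¹)⁻¹ = _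
      rw [inv_mul_cancel, one_mul, inv_inv]
    rw [h2, inv_mul_cancel]

/-- **Class-level converse**: a class `x ∈ H¹(H, A)` whose restriction to `A` is the identity class
`[id] ∈ H¹(A, A) = Hom(A, A)` yields a topological complement: `H = A · K`, `A ⊓ K = ⊥`, with a
CONTINUOUS retraction `r : H → A` (`r(h)⁻¹ h ∈ K`, `r|_A = id`).
[cite: Brown1982CohomologyGroups, Ch. IV §2 Prop. 2.1 and Prop. 2.3] -/
theorem exists_complement_of_res_eq (hAH : A ≤ H) (x : ContH1 (MonoidHom.id G) A H)
    (hx : ContH1.res (MonoidHom.id G) A hAH x = ContH1.mk (fun a : A => a) id_mem_contCocycles) :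
    ∃ K : Subgroup G, K ≤ H ∧ Disjoint A K ∧ ∃ r : H → A, Continuous r ∧
      (∀ a : A, r ⟨a, hAH a.2⟩ = a) ∧ (∀ h : H, ((r h : G))⁻¹ * (h : G) ∈ K) ∧
      ∀ h : H, (h : G) ∈ K ↔ r h = 1 := by
  induction x using QuotientGroup.induction_on with
  | H f =>
    have hres : ContH1.mk _ (ContH1.resCocycle (MonoidHom.id G) A hAH f).2 =
        ContH1.mk (fun a : A => a) id_mem_contCocycles := hx
    have hfA : ∀ a : A, f.1 ⟨a, hAH a.2⟩ = a := fun a =>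
      congrFun (cocycle_eq_of_mk_eq_self _ _ _ _ hres) a
    obtain ⟨K, hKH, -, hdisj, hπK, hmem⟩ := exists_complement_of_cocycle hAH f hfA
    exact ⟨K, hKH, hdisj, f.1, f.2.1, hfA, hπK, hmem⟩

end Converse

end ContH1

/-! ### [EtTh] §1: the clauses of Prop. 1.5 on the group side -/

namespace ThetaSetting

open Literature.AnabelianGeometry.SemiGraphs

variable {p : ℕ} [Fact p.Prime] {D : ThetaSetting p}

/-- **A topological complement of `Δ_Θ` lifts `log(Θ)`.** If a subgroup `H' ≤ (Π^tp_X)^Θ` containing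
`Δ_Θ` is a topological semidirect product `H' = Δ_Θ ⋊ K` (continuous `Δ_Θ`-coordinate `π`,
`Δ_Θ ⊓ K = ⊥`), then some class of `H¹(H', Δ_Θ)` restricts to `log(Θ) ∈ H¹(Δ_Θ, Δ_Θ)` — the group-side
content of "arises from a [unique] class … that maps to `log(Θ)`" (Prop. 1.5 (iii), p. 23), at any such
`H'`. [cite: MochizukiEtTh2009, Prop 1.5 (iii) p.23] -/
theorem exists_res_eq_logTheta_of_complement {H' K : Subgroup D.GtpTheta}
    (hΔ : D.DeltaTheta ≤ H') (hdisj : Disjoint D.DeltaTheta K) (π : H' → D.DeltaTheta)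
    (hπK : ∀ h : H', ((π h : D.GtpTheta))⁻¹ * (h : D.GtpTheta) ∈ K) (hπc : Continuous π) :
    ∃ x : D.H1Theta H', ContH1.res (MonoidHom.id D.GtpTheta) D.DeltaTheta hΔ x = D.logTheta := by
  have hKN : K ≤ Subgroup.normalizer (D.DeltaTheta : Set D.GtpTheta) :=
    Subgroup.le_normalizer_of_normal
  obtain ⟨x, hx⟩ := ContH1.exists_res_eq_mk_of_complement (φ := MonoidHom.id D.GtpTheta)
    (A := D.DeltaTheta) hΔ hKN hdisj π hπK hπc ⟨fun a => a, ContH1.id_mem_contCocycles⟩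
    (fun k _ n n' h => by rw [MonoidHom.id_apply, ← h])
  exact ⟨x, hx⟩

/-- **`F⁰/F¹ = Hom(Δ_Θ, Δ_Θ)` from a topological splitting.** If `H' = Δ_Θ ⋊ K` topologically and every
continuous endomorphism-cocycle of `Δ_Θ` is `K`-equivariant (e.g. `Δ_Θ ≅ Ẑ` with `K` acting through
`Ẑ^×`), then restriction `H¹(H', Δ_Θ) → H¹(Δ_Θ, Δ_Θ)` is SURJECTIVE — the clause
`res_deltaTheta_surjective` of `Prop15i` (`H' = (Π^tp_Y)^Θ`) / `Prop15ii` (`H' = (Π^tp_Ÿ)^Θ`)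
("`F⁰/F¹ = Hom(Δ_Θ, Δ_Θ) = Ẑ · log(Θ)`", Prop. 1.5 (i)(ii), p. 23). [cite: MochizukiEtTh2009, Prop 1.5 (i) p.23] -/
theorem res_deltaTheta_surjective_of_complement {H' K : Subgroup D.GtpTheta}
    (hΔ : D.DeltaTheta ≤ H') (hdisj : Disjoint D.DeltaTheta K) (π : H' → D.DeltaTheta)
    (hπK : ∀ h : H', ((π h : D.GtpTheta))⁻¹ * (h : D.GtpTheta) ∈ K) (hπc : Continuous π)
    (hequiv : ∀ c : contCocycles (MonoidHom.id D.GtpTheta) D.DeltaTheta D.DeltaTheta,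
      ∀ k : D.GtpTheta, k ∈ K → ∀ a a' : D.DeltaTheta, k * a * k⁻¹ = a' →
        ((c.1 a' : D.DeltaTheta) : D.GtpTheta) = k * c.1 a * k⁻¹) :
    Function.Surjective
      (ContH1.res (MonoidHom.id D.GtpTheta) D.DeltaTheta hΔ : D.H1Theta H' → D.H1Theta D.DeltaTheta) := by
  have hKN : K ≤ Subgroup.normalizer (D.DeltaTheta : Set D.GtpTheta) :=
    Subgroup.le_normalizer_of_normal
  exact ContH1.res_surjective_of_complement (φ := MonoidHom.id D.GtpTheta) (A := D.DeltaTheta)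
    hΔ hKN hdisj π hπK hπc (fun c k hk a a' h => by simpa only [MonoidHom.id_apply] using hequiv c k hk a a' h)

/-- **Conversely, a lift of `log(Θ)` splits the group.** A class of `H¹(H', Δ_Θ)` (`Δ_Θ ≤ H' ≤ (Π^tp_X)^Θ`)
restricting to `log(Θ)` yields `H' = Δ_Θ ⋊ K` topologically: `Δ_Θ ⊓ K = ⊥`, a continuous retraction
`r : H' → Δ_Θ` with `r|_{Δ_Θ} = id`, `r(h)⁻¹ h ∈ K`, and `K = {r = 1}`.
[cite: MochizukiEtTh2009, Prop 1.5 (iii) p.23] -/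
theorem exists_complement_of_res_eq_logTheta {H' : Subgroup D.GtpTheta} (hΔ : D.DeltaTheta ≤ H')
    (x : D.H1Theta H') (hx : ContH1.res (MonoidHom.id D.GtpTheta) D.DeltaTheta hΔ x = D.logTheta) :
    ∃ K : Subgroup D.GtpTheta, K ≤ H' ∧ Disjoint D.DeltaTheta K ∧ ∃ r : H' → D.DeltaTheta,
      Continuous r ∧ (∀ a : D.DeltaTheta, r ⟨a, hΔ a.2⟩ = a) ∧
      (∀ h : H', ((r h : D.GtpTheta))⁻¹ * (h : D.GtpTheta) ∈ K) ∧
      ∀ h : H', (h : D.GtpTheta) ∈ K ↔ r h = 1 := by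
  have hlog : D.logTheta = ContH1.mk (fun a : D.DeltaTheta => a) ContH1.id_mem_contCocycles :=
    ContH1.mk_congr _ rfl _ _
  rw [hlog] at hx
  exact ContH1.exists_complement_of_res_eq hΔ x hx

/-- **What the typed Prop. 1.5 (iii) forces on `(Π^tp_Ÿ)^Θ`.** Under `Prop15iii E hC` (t1's predicate:
every theta class lifts to `(Π^tp_Ÿ)^Θ` with restriction `log(Θ)` on `Δ_Θ`), applied to the member
`η̈^Θ ∈ O^×_K̈ · η̈^Θ`, the group `(Π^tp_Ÿ)^Θ` is a topological semidirect product `Δ_Θ ⋊ K`, `K` the kernel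
of the (continuous) retraction representing the lift. [cite: MochizukiEtTh2009, Prop 1.5 (iii) p.23] -/
theorem Prop15iii.exists_complement {E : D.EtaleThetaData} {hC : D.Compat} (h15 : Prop15iii E hC) :
    ∃ K : Subgroup D.GtpTheta, K ≤ D.GtpYdd.map D.toTheta ∧ Disjoint D.DeltaTheta K ∧
      ∃ r : ↥(D.GtpYdd.map D.toTheta) → D.DeltaTheta, Continuous r ∧
        (∀ a : D.DeltaTheta,
          r ⟨a, (hC.deltaTheta_le_DtpYddTheta.trans (Subgroup.map_mono inf_le_left)) a.2⟩ = a) ∧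
        (∀ h : ↥(D.GtpYdd.map D.toTheta), ((r h : D.GtpTheta))⁻¹ * (h : D.GtpTheta) ∈ K) ∧
        ∀ h : ↥(D.GtpYdd.map D.toTheta), (h : D.GtpTheta) ∈ K ↔ r h = 1 := by
  have hη : E.etaDd ∈ E.thetaClasses := ⟨1, one_mem _, by rw [one_mul]⟩
  obtain ⟨x', ⟨-, hres, -⟩, -⟩ := h15 E.etaDd hη
  exact exists_complement_of_res_eq_logTheta _ x' hres

end ThetaSetting

end Literature.AnabelianGeometry.EtaleTheta
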